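import Mathlib

/-!
# The one-step "mass-transfer" contraction behind THEOREM A — abstract form, with explicit constant
# (THEORY-1 §12.3, Parts A/B), and its geometric iteration

HONEST FRAMING: exact (Metropolis-corrected) sampling algorithms for lattice gauge theory; figures
of merit are autocorrelation/cost numbers at stated couplings and volumes; no continuum-physics claim.

Proposed tree file: `Summits/Ventures/LatticeQCDFlow/TrivializingMaps/MassTransferContraction.lean`
(namespace `Summit.Ventures.LatticeQCDFlow.TrivializingMaps.MassTransfer`). Mathlib only; everything
here is PROVED (no `sorry`, no new axioms); nothing here is a Literature fact.

## What is here

The U(1) one-step contraction `Abelian.AbelianStepContraction` (tree `AbelianRadius.lean`, proved in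
`AbelianContraction.lean`) — "if every link norm of the Fourier family `a` is `≤ M`, every link norm of one
Lüscher step `stepR a` is `≤ D(1+8/g)·M`" — is an instance of the following ABSTRACT inequality, which is
the combinatorial heart of THEORY-1 §12.3 for a general compact gauge group (the volume-uniform rate
`ρ ≥ 1/θ₀` of THEOREM A):

* a finite LINK COMPLEX (`LinkComplex`): links `E`, plaquettes `P`, each plaquette `p` carrying a set
  `links p` of at most four links, at most `D` plaquettes through any link;
* MODE WEIGHTS (`ModeWeights`): an arbitrary index type `M` of "modes" (U(1): `ℤ^E`; SU(n): assignments
  of dominant weights to links), nonnegative link weights `w m e` (U(1): `|m_e|`; SU(n): the size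
  `|λ_e|` of the weight at `e`), total weight `|m| = ∑_e w m e`, and a "Casimir" `c m` with
  `κ·|m| ≤ c m` (U(1): `c(m) = ∑ m_e² ≥ ∑ |m_e|`, `κ = 1`; SU(n): `∑_e C₂(λ_e) ≥ κ ∑_e |λ_e|`);
* ONE TRANSFER STEP (`IsTransferStep`): input masses `ν ≥ 0` on a finite set `Sf` of modes, output
  masses `ν'` on `Sb`, and nonnegative transfer amounts `T p e' n m` ("mass moved from the input mode
  `n` to the output mode `m` by the vertex `(∂_{e'} S₁^{(p)})·∂_{e'}`") with
  (T1, `balance`) `c m · ν' m ≤ ∑_{p, e' ∈ p, n} T p e' n m` (the step divides by the Casimir: `-Δ⁻¹P`),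
  (T2, `emit`)    `∑_m T p e' n m ≤ Γ · w n e' · ν n` (a derivative at `e'` costs the weight at `e'`),
  (T3, locality)  `T p e' n m ≠ 0 ⇒ w m ≤ w n` off `p`, `w m ≤ w n + σ` on `p`, `|n| ≤ |m| + 4σ`
                  (tensoring with the plaquette representation moves weights by `≤ σ`, only on `p`),
  (G, `gap`)      `γ ≤ c m` on output modes (girth / spectral gap of `-Δ` on the modes that occur).

CONCLUSION (`linkMass_le`): the LINK MASSES `N_e(ν) = ∑_n w n e · ν n` contract with an explicit factor,
`sup_e N_e(ν') ≤ θ₀ · sup_e N_e(ν)`, `θ₀ = D · Γ · (1/κ + 8σ/γ)`;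
and (`linkMass_iterate_le`) along a sequence of such steps `N_e(ν_k) ≤ θ₀^k · N₀`.

Proof = THEORY-1 §12.3 verbatim: PART A (weight at `e` inherited from the parent mode `n`) is bounded
through `|n| / max(γ, κ(|n| - 4σ)) ≤ 1/κ + 4σ/γ` (`ratio_le`) and `∑_{(p, e' ∈ p)} w n e' ≤ D|n|`
(`sum_links_le`); PART B (weight created at `e` by the `≤ D` plaquettes through `e`, four links each)
gives `4Dσ/γ`. U(1) check: `κ = σ = Γ = 1`, `γ = g` gives `θ₀ = D(1 + 8/g)`, the constant of
`AbelianStepContraction`.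

## What is NOT here

This file does not prove THEOREM A for `SU(n)`. That the link gradients of the Wilson-action Lüscher
series `wilsonSk` are DOMINATED by link masses of mode data satisfying (T1)–(T3), (G) with constants
uniform in the lattice size (Peter–Weyl on `SU(n)^E`, Casimir weights, the Fourier-algebra norm;
THEORY-1 §12.2 (F1)–(F5)) is a separate, classical but unformalised obligation, typed as
`HasLocalModeNorm` in `LocalModeNorm.lean` (venture side, never Literature, not asserted). What is
kernel-checked here is the part of the argument that is OURS: the contraction with its constant.
-/

namespace Summit.Ventures.LatticeQCDFlow.TrivializingMaps.MassTransfer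

open Finset

/-! ## The data -/

/-- A finite link/plaquette incidence structure: a finite set `plaqs` of plaquettes (interaction terms) in an
index type `P`, plaquette `p` consisting of the links `links p` (at most four of them), and at most `D`
plaquettes through any link (torus `(ℤ/L)^d`, `L ≥ 3`: `D = 2(d-1)`). No instances on `P` are needed. -/
structure LinkComplex (E P : Type*) [Fintype E] [DecidableEq E] where
  /-- the (finite set of) plaquettes -/
  plaqs : Finset P
  /-- the links of a plaquette -/
  links : P → Finset E
  /-- at most four links per plaquette -/
  card_links_le : ∀ p, (links p).card ≤ 4
  /-- a bound on the number of plaquettes through a link -/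
  D : ℕ
  /-- at most `D` plaquettes through any link -/
  card_through_le : ∀ e, (plaqs.filter fun p => e ∈ links p).card ≤ D

/-- Mode weights on an index type `M`: nonnegative link weights `w m e`, and a "Casimir" `c m` bounded
below by `κ` times the total weight `∑_e w m e`, `κ > 0`. -/
structure ModeWeights (E M : Type*) [Fintype E] where
  /-- the weight of the mode `m` at the link `e` -/
  w : M → E → ℝ
  w_nonneg : ∀ m e, 0 ≤ w m e
  /-- the Casimir (eigenvalue of `-Δ`) of the mode `m` -/
  c : M → ℝ
  /-- Casimir-versus-weight constant -/
  κ : ℝ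
  κ_pos : 0 < κ
  /-- `κ · |m| ≤ c(m)` -/
  casimir_ge : ∀ m, κ * ∑ e, w m e ≤ c m

namespace ModeWeights

variable {E M : Type*} [Fintype E] (W : ModeWeights E M)

/-- Total weight `|m| = ∑_e w m e`. -/
def tw (m : M) : ℝ := ∑ e, W.w m e

/-- LINK MASS at `e` of a mass profile `ν` on the finite mode set `S`: `N_e(ν) = ∑_{n ∈ S} w n e · ν n`. -/
def linkMass (S : Finset M) (ν : M → ℝ) (e : E) : ℝ := ∑ n ∈ S, W.w n e * ν n

/-- `|m| ≥ 0`. [folklore] -/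
theorem tw_nonneg (m : M) : 0 ≤ W.tw m := Finset.sum_nonneg fun e _ => W.w_nonneg m e

/-- `N_e(ν) ≥ 0` for `ν ≥ 0`. [folklore] -/
theorem linkMass_nonneg {S : Finset M} {ν : M → ℝ} (hν : ∀ n ∈ S, 0 ≤ ν n) (e : E) :
    0 ≤ W.linkMass S ν e :=
  Finset.sum_nonneg fun n hn => mul_nonneg (W.w_nonneg n e) (hν n hn)

/-- The total-weight shift `|n| ≤ |m| + 4σ` of (T3) follows from two-sided locality on a plaquette with at
most four links (PROVED; offered to instance builders). [folklore] -/
theorem tw_le_of_local [DecidableEq E] (s : Finset E) (hs : s.card ≤ 4) {σ : ℝ} (hσ : 0 ≤ σ) {n m : M}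
    (hoff : ∀ e, e ∉ s → W.w n e ≤ W.w m e) (hon : ∀ e ∈ s, W.w n e ≤ W.w m e + σ) :
    W.tw n ≤ W.tw m + 4 * σ := by
  unfold tw
  calc ∑ e, W.w n e ≤ ∑ e, (W.w m e + if e ∈ s then σ else 0) := by
        refine Finset.sum_le_sum fun e _ => ?_
        split_ifs with he
        · exact hon e he
        · simpa using hoff e he
    _ = ∑ e, W.w m e + ∑ e, (if e ∈ s then σ else 0) := Finset.sum_add_distrib
    _ = ∑ e, W.w m e + s.card * σ := by
        congr 1
        rw [← Finset.sum_filter, Finset.filter_univ_mem, Finset.sum_const, nsmul_eq_mul]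
    _ ≤ ∑ e, W.w m e + 4 * σ := by
        have : (s.card : ℝ) * σ ≤ 4 * σ := mul_le_mul_of_nonneg_right (by exact_mod_cast hs) hσ
        linarith

end ModeWeights

/-! ## One transfer step -/

section Step

variable {E P M : Type*} [Fintype E] [DecidableEq E]

/-- ONE TRANSFER STEP with constants `(σ, γ, Γ)`: input masses `ν` on `Sf`, output masses `ν'` on `Sb`,
transfer amounts `T p e' n m ≥ 0`, satisfying (T1) `balance`, (T2) `emit`, (T3) `local_off` /
`local_on` / `tw_le`, (G) `gap` (module docstring). [ours; THEORY-1 §12.2–12.3] -/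
structure IsTransferStep (K : LinkComplex E P) (W : ModeWeights E M) (σ γ Γ : ℝ)
    (Sf Sb : Finset M) (ν ν' : M → ℝ) (T : P → E → M → M → ℝ) : Prop where
  σ_nonneg : 0 ≤ σ
  γ_pos : 0 < γ
  Γ_nonneg : 0 ≤ Γ
  ν_nonneg : ∀ n ∈ Sf, 0 ≤ ν n
  T_nonneg : ∀ p ∈ K.plaqs, ∀ e' n m, 0 ≤ T p e' n m
  /-- (G) spectral gap on the output modes -/
  gap : ∀ m ∈ Sb, γ ≤ W.c m
  /-- (T1) the output mass at `m`, times its Casimir, is at most the total mass transferred into `m` -/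
  balance : ∀ m ∈ Sb, W.c m * ν' m ≤ ∑ p ∈ K.plaqs, ∑ e' ∈ K.links p, ∑ n ∈ Sf, T p e' n m
  /-- (T2) the vertex at `(p, e')` moves at most `Γ · w n e' · ν n` out of the input mode `n` -/
  emit : ∀ p ∈ K.plaqs, ∀ e' ∈ K.links p, ∀ n ∈ Sf, ∑ m ∈ Sb, T p e' n m ≤ Γ * W.w n e' * ν n
  /-- (T3a) off the plaquette the weights do not grow -/
  local_off : ∀ p ∈ K.plaqs, ∀ e' n m, T p e' n m ≠ 0 → ∀ e, e ∉ K.links p → W.w m e ≤ W.w n e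
  /-- (T3b) on the plaquette the weights grow by at most `σ` -/
  local_on : ∀ p ∈ K.plaqs, ∀ e' n m, T p e' n m ≠ 0 → ∀ e ∈ K.links p, W.w m e ≤ W.w n e + σ
  /-- (T3c) the total weight drops by at most `4σ` -/
  tw_le : ∀ p ∈ K.plaqs, ∀ e' n m, T p e' n m ≠ 0 → W.tw n ≤ W.tw m + 4 * σ

/-- The elementary real inequality behind PART A: `s ≤ (1/κ + 4σ/γ) · max(γ, κ(s - 4σ))` (all real `s`)
(PROVED). [folklore] -/
theorem ratio_le {κ γ σ : ℝ} (hκ : 0 < κ) (hγ : 0 < γ) (hσ : 0 ≤ σ) (s : ℝ) :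
    s ≤ (1 / κ + 4 * σ / γ) * max γ (κ * (s - 4 * σ)) := by
  have hκ' : κ ≠ 0 := hκ.ne'; have hγ' : γ ≠ 0 := hγ.ne'
  rcases le_or_gt (κ * (s - 4 * σ)) γ with h | h
  · rw [max_eq_left h]
    have h1 : s - 4 * σ ≤ γ / κ := by rw [le_div_iff₀ hκ]; linarith
    have h2 : (1 / κ + 4 * σ / γ) * γ = γ / κ + 4 * σ := by field_simp
    linarith
  · rw [max_eq_right h.le]
    have h3 : (1 / κ + 4 * σ / γ) * (κ * (s - 4 * σ)) =
        (s - 4 * σ) + 4 * σ / γ * (κ * (s - 4 * σ)) := by field_simp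
    have h4 : 4 * σ / γ * γ ≤ 4 * σ / γ * (κ * (s - 4 * σ)) :=
      mul_le_mul_of_nonneg_left h.le (by positivity)
    have h5 : 4 * σ / γ * γ = 4 * σ := by field_simp
    linarith

/-- `∑_{p} ∑_{e' ∈ p} f e' ≤ D · ∑_{e'} f e'` for `f ≥ 0` (each link lies in at most `D` plaquettes)
(PROVED). [folklore] -/
theorem sum_links_le (K : LinkComplex E P) (f : E → ℝ) (hf : ∀ e, 0 ≤ f e) :
    ∑ p ∈ K.plaqs, ∑ e' ∈ K.links p, f e' ≤ K.D * ∑ e', f e' := by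
  have hswap : ∑ p ∈ K.plaqs, ∑ e' ∈ K.links p, f e' =
      ∑ e', ∑ p ∈ K.plaqs.filter (fun p => e' ∈ K.links p), f e' := by
    exact Finset.sum_comm' fun p e' => by simp
  rw [hswap, Finset.mul_sum]
  refine Finset.sum_le_sum fun e' _ => ?_
  rw [Finset.sum_const, nsmul_eq_mul]
  exact mul_le_mul_of_nonneg_right (by exact_mod_cast K.card_through_le e') (hf e')

variable {K : LinkComplex E P} {W : ModeWeights E M} {σ γ Γ : ℝ} {Sf Sb : Finset M} {ν ν' : M → ℝ}
  {T : P → E → M → M → ℝ}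

/-- Per-term bound (THEORY-1 §12.3): for an output mode `m` fed by `n` through `(p, e')`,
`(w m e / c m) · T ≤ (w n e · R(n) + σ·[e ∈ p] / γ) · T`, `R(n) = 1 / max(γ, κ(|n| - 4σ))` (PROVED). -/
theorem term_le (h : IsTransferStep K W σ γ Γ Sf Sb ν ν' T) {m : M} (hm : m ∈ Sb) {p : P}
    (hp : p ∈ K.plaqs) (e' : E) (n : M) (e : E) :
    W.w m e / W.c m * T p e' n m ≤
      (W.w n e * (1 / max γ (W.κ * (W.tw n - 4 * σ))) + (if e ∈ K.links p then σ else 0) * (1 / γ)) *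
        T p e' n m := by
  by_cases hT : T p e' n m = 0
  · simp [hT]
  have hγ := h.γ_pos
  have hmaxpos : 0 < max γ (W.κ * (W.tw n - 4 * σ)) := lt_max_of_lt_left hγ
  have hc : max γ (W.κ * (W.tw n - 4 * σ)) ≤ W.c m := by
    refine max_le (h.gap m hm) ?_
    calc W.κ * (W.tw n - 4 * σ) ≤ W.κ * W.tw m :=
          mul_le_mul_of_nonneg_left (by linarith [h.tw_le p hp e' n m hT]) W.κ_pos.le
      _ ≤ W.c m := W.casimir_ge m
  have hcpos : 0 < W.c m := lt_of_lt_of_le hmaxpos hc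
  have hinvR : 1 / W.c m ≤ 1 / max γ (W.κ * (W.tw n - 4 * σ)) :=
    one_div_le_one_div_of_le hmaxpos hc
  have hinvγ : 1 / W.c m ≤ 1 / γ := one_div_le_one_div_of_le hγ (h.gap m hm)
  have hbump0 : 0 ≤ (if e ∈ K.links p then σ else 0) := by split_ifs; exacts [h.σ_nonneg, le_rfl]
  have hw : W.w m e ≤ W.w n e + (if e ∈ K.links p then σ else 0) := by
    split_ifs with he
    · exact h.local_on p hp e' n m hT e he
    · simpa using h.local_off p hp e' n m hT e he
  refine mul_le_mul_of_nonneg_right ?_ (h.T_nonneg p hp e' n m)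
  calc W.w m e / W.c m = W.w m e * (1 / W.c m) := by rw [← div_eq_mul_one_div]
    _ ≤ (W.w n e + (if e ∈ K.links p then σ else 0)) * (1 / W.c m) :=
        mul_le_mul_of_nonneg_right hw (by positivity)
    _ = W.w n e * (1 / W.c m) + (if e ∈ K.links p then σ else 0) * (1 / W.c m) := by ring
    _ ≤ W.w n e * (1 / max γ (W.κ * (W.tw n - 4 * σ))) +
          (if e ∈ K.links p then σ else 0) * (1 / γ) :=
        add_le_add (mul_le_mul_of_nonneg_left hinvR (W.w_nonneg n e))
          (mul_le_mul_of_nonneg_left hinvγ hbump0)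

/-- **THE ONE-STEP CONTRACTION (THEORY-1 §12.3, Parts A/B; ours, PROVED).** If every link mass of the
input profile is `≤ N`, every link mass of the output profile is `≤ D · Γ · (1/κ + 8σ/γ) · N`. -/
theorem linkMass_le (h : IsTransferStep K W σ γ Γ Sf Sb ν ν' T) {N : ℝ}
    (hN : ∀ e, W.linkMass Sf ν e ≤ N) (e : E) :
    W.linkMass Sb ν' e ≤ K.D * Γ * (1 / W.κ + 8 * σ / γ) * N := by
  have hκ := W.κ_pos; have hγ := h.γ_pos; have hσ := h.σ_nonneg; have hΓ := h.Γ_nonneg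
  have hN0 : 0 ≤ N := (W.linkMass_nonneg h.ν_nonneg e).trans (hN e)
  -- abbreviations
  set R : M → ℝ := fun n => 1 / max γ (W.κ * (W.tw n - 4 * σ)) with hRdef
  set bump : P → ℝ := fun p => if e ∈ K.links p then σ else 0 with hbumpdef
  have hR0 : ∀ n, 0 ≤ R n := fun n => by
    have : 0 < max γ (W.κ * (W.tw n - 4 * σ)) := lt_max_of_lt_left hγ
    simp only [hRdef]; positivity
  have hbump0 : ∀ p, 0 ≤ bump p := fun p => by
    simp only [hbumpdef]; split_ifs; exacts [hσ, le_rfl]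
  -- Step 0: divide by the Casimir (T1)
  have h0 : W.linkMass Sb ν' e ≤
      ∑ m ∈ Sb, ∑ p ∈ K.plaqs, ∑ e' ∈ K.links p, ∑ n ∈ Sf, W.w m e / W.c m * T p e' n m := by
    unfold ModeWeights.linkMass
    refine Finset.sum_le_sum fun m hm => ?_
    have hcpos : 0 < W.c m := lt_of_lt_of_le hγ (h.gap m hm)
    calc W.w m e * ν' m ≤ W.w m e * ((∑ p ∈ K.plaqs, ∑ e' ∈ K.links p, ∑ n ∈ Sf, T p e' n m) / W.c m) :=
          mul_le_mul_of_nonneg_left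
            ((le_div_iff₀ hcpos).mpr (by rw [mul_comm]; exact h.balance m hm)) (W.w_nonneg m e)
      _ = W.w m e / W.c m * ∑ p ∈ K.plaqs, ∑ e' ∈ K.links p, ∑ n ∈ Sf, T p e' n m := by ring
      _ = ∑ p ∈ K.plaqs, ∑ e' ∈ K.links p, ∑ n ∈ Sf, W.w m e / W.c m * T p e' n m := by
          simp only [Finset.mul_sum]
  -- Step 1: reorder, bound termwise (`term_le`), and use (T2)
  have hswap : ∑ m ∈ Sb, ∑ p ∈ K.plaqs, ∑ e' ∈ K.links p, ∑ n ∈ Sf, W.w m e / W.c m * T p e' n m =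
      ∑ p ∈ K.plaqs, ∑ e' ∈ K.links p, ∑ n ∈ Sf, ∑ m ∈ Sb, W.w m e / W.c m * T p e' n m := by
    rw [Finset.sum_comm]
    refine Finset.sum_congr rfl fun p _ => ?_
    rw [Finset.sum_comm]
    refine Finset.sum_congr rfl fun e' _ => ?_
    rw [Finset.sum_comm]
  have h1 : ∑ p ∈ K.plaqs, ∑ e' ∈ K.links p, ∑ n ∈ Sf, ∑ m ∈ Sb, W.w m e / W.c m * T p e' n m ≤
      ∑ p ∈ K.plaqs, ∑ e' ∈ K.links p, ∑ n ∈ Sf, (W.w n e * R n + bump p * (1 / γ)) * (Γ * W.w n e' * ν n) := by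
    refine Finset.sum_le_sum fun p hp => Finset.sum_le_sum fun e' he' => Finset.sum_le_sum fun n hn => ?_
    have hfac : 0 ≤ W.w n e * R n + bump p * (1 / γ) :=
      add_nonneg (mul_nonneg (W.w_nonneg n e) (hR0 n)) (mul_nonneg (hbump0 p) (by positivity))
    calc ∑ m ∈ Sb, W.w m e / W.c m * T p e' n m
        ≤ ∑ m ∈ Sb, (W.w n e * R n + bump p * (1 / γ)) * T p e' n m :=
          Finset.sum_le_sum fun m hm => term_le h hm hp e' n e
      _ = (W.w n e * R n + bump p * (1 / γ)) * ∑ m ∈ Sb, T p e' n m := by rw [Finset.mul_sum]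
      _ ≤ (W.w n e * R n + bump p * (1 / γ)) * (Γ * W.w n e' * ν n) :=
          mul_le_mul_of_nonneg_left (h.emit p hp e' he' n hn) hfac
  -- Step 2: split into PART A and PART B
  have hsplit : ∑ p ∈ K.plaqs, ∑ e' ∈ K.links p, ∑ n ∈ Sf, (W.w n e * R n + bump p * (1 / γ)) * (Γ * W.w n e' * ν n)
      = (∑ p ∈ K.plaqs, ∑ e' ∈ K.links p, ∑ n ∈ Sf, W.w n e * R n * (Γ * W.w n e' * ν n)) +
        ∑ p ∈ K.plaqs, ∑ e' ∈ K.links p, ∑ n ∈ Sf, bump p * (1 / γ) * (Γ * W.w n e' * ν n) := by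
    simp only [add_mul, Finset.sum_add_distrib]
  -- PART A
  have hPartA : ∑ p ∈ K.plaqs, ∑ e' ∈ K.links p, ∑ n ∈ Sf, W.w n e * R n * (Γ * W.w n e' * ν n)
      ≤ K.D * Γ * (1 / W.κ + 4 * σ / γ) * N := by
    -- bring the `n`-sum outside
    have hre : ∑ p ∈ K.plaqs, ∑ e' ∈ K.links p, ∑ n ∈ Sf, W.w n e * R n * (Γ * W.w n e' * ν n)
        = ∑ n ∈ Sf, (Γ * (W.w n e * ν n) * R n) * ∑ p ∈ K.plaqs, ∑ e' ∈ K.links p, W.w n e' := by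
      have : ∑ p ∈ K.plaqs, ∑ e' ∈ K.links p, ∑ n ∈ Sf, W.w n e * R n * (Γ * W.w n e' * ν n)
          = ∑ p ∈ K.plaqs, ∑ n ∈ Sf, ∑ e' ∈ K.links p, W.w n e * R n * (Γ * W.w n e' * ν n) :=
        Finset.sum_congr rfl fun p _ => Finset.sum_comm
      rw [this, Finset.sum_comm]
      refine Finset.sum_congr rfl fun n _ => ?_
      rw [Finset.mul_sum]
      refine Finset.sum_congr rfl fun p _ => ?_
      rw [Finset.mul_sum]
      refine Finset.sum_congr rfl fun e' _ => ?_
      ring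
    rw [hre]
    have hstep : ∀ n ∈ Sf, (Γ * (W.w n e * ν n) * R n) * ∑ p ∈ K.plaqs, ∑ e' ∈ K.links p, W.w n e'
        ≤ K.D * Γ * (1 / W.κ + 4 * σ / γ) * (W.w n e * ν n) := by
      intro n hn
      have hwν : 0 ≤ W.w n e * ν n := mul_nonneg (W.w_nonneg n e) (h.ν_nonneg n hn)
      have hD : ∑ p ∈ K.plaqs, ∑ e' ∈ K.links p, W.w n e' ≤ K.D * W.tw n :=
        sum_links_le K (W.w n) (W.w_nonneg n)
      have hratio : W.tw n * R n ≤ 1 / W.κ + 4 * σ / γ := by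
        have hmaxpos : 0 < max γ (W.κ * (W.tw n - 4 * σ)) := lt_max_of_lt_left hγ
        simp only [hRdef]
        rw [← div_eq_mul_one_div, div_le_iff₀ hmaxpos]
        exact ratio_le hκ hγ hσ (W.tw n)
      calc (Γ * (W.w n e * ν n) * R n) * ∑ p ∈ K.plaqs, ∑ e' ∈ K.links p, W.w n e'
          ≤ (Γ * (W.w n e * ν n) * R n) * (K.D * W.tw n) :=
            mul_le_mul_of_nonneg_left hD (mul_nonneg (mul_nonneg hΓ hwν) (hR0 n))
        _ = K.D * Γ * (W.tw n * R n) * (W.w n e * ν n) := by ring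
        _ ≤ K.D * Γ * (1 / W.κ + 4 * σ / γ) * (W.w n e * ν n) := by
            refine mul_le_mul_of_nonneg_right ?_ hwν
            exact mul_le_mul_of_nonneg_left hratio (by positivity)
    calc ∑ n ∈ Sf, (Γ * (W.w n e * ν n) * R n) * ∑ p ∈ K.plaqs, ∑ e' ∈ K.links p, W.w n e'
        ≤ ∑ n ∈ Sf, K.D * Γ * (1 / W.κ + 4 * σ / γ) * (W.w n e * ν n) := Finset.sum_le_sum hstep
      _ = K.D * Γ * (1 / W.κ + 4 * σ / γ) * W.linkMass Sf ν e := by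
          rw [ModeWeights.linkMass, Finset.mul_sum]
      _ ≤ K.D * Γ * (1 / W.κ + 4 * σ / γ) * N :=
          mul_le_mul_of_nonneg_left (hN e) (by positivity)
  -- PART B
  have hPartB : ∑ p ∈ K.plaqs, ∑ e' ∈ K.links p, ∑ n ∈ Sf, bump p * (1 / γ) * (Γ * W.w n e' * ν n)
      ≤ K.D * Γ * (4 * σ / γ) * N := by
    have hinner : ∀ p, ∑ e' ∈ K.links p, ∑ n ∈ Sf, bump p * (1 / γ) * (Γ * W.w n e' * ν n)
        ≤ bump p * (1 / γ) * Γ * (4 * N) := by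
      intro p
      have hfac : 0 ≤ bump p * (1 / γ) * Γ := mul_nonneg (mul_nonneg (hbump0 p) (by positivity)) hΓ
      calc ∑ e' ∈ K.links p, ∑ n ∈ Sf, bump p * (1 / γ) * (Γ * W.w n e' * ν n)
          = ∑ e' ∈ K.links p, bump p * (1 / γ) * Γ * W.linkMass Sf ν e' := by
            refine Finset.sum_congr rfl fun e' _ => ?_
            rw [ModeWeights.linkMass, Finset.mul_sum]
            refine Finset.sum_congr rfl fun n _ => ?_
            ring
        _ ≤ ∑ e' ∈ K.links p, bump p * (1 / γ) * Γ * N :=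
            Finset.sum_le_sum fun e' _ => mul_le_mul_of_nonneg_left (hN e') hfac
        _ = (K.links p).card * (bump p * (1 / γ) * Γ * N) := by
            rw [Finset.sum_const, nsmul_eq_mul]
        _ ≤ 4 * (bump p * (1 / γ) * Γ * N) :=
            mul_le_mul_of_nonneg_right (by exact_mod_cast K.card_links_le p) (mul_nonneg hfac hN0)
        _ = bump p * (1 / γ) * Γ * (4 * N) := by ring
    have hbumpsum : ∑ p ∈ K.plaqs, bump p ≤ σ * K.D := by
      simp only [hbumpdef]
      rw [← Finset.sum_filter, Finset.sum_const, nsmul_eq_mul, mul_comm]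
      exact mul_le_mul_of_nonneg_left (by exact_mod_cast K.card_through_le e) hσ
    calc ∑ p ∈ K.plaqs, ∑ e' ∈ K.links p, ∑ n ∈ Sf, bump p * (1 / γ) * (Γ * W.w n e' * ν n)
        ≤ ∑ p ∈ K.plaqs, bump p * (1 / γ) * Γ * (4 * N) := Finset.sum_le_sum fun p _ => hinner p
      _ = (∑ p ∈ K.plaqs, bump p) * ((1 / γ) * Γ * (4 * N)) := by
          rw [Finset.sum_mul]
          refine Finset.sum_congr rfl fun p _ => ?_
          ring
      _ ≤ (σ * K.D) * ((1 / γ) * Γ * (4 * N)) :=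
          mul_le_mul_of_nonneg_right hbumpsum (by positivity)
      _ = K.D * Γ * (4 * σ / γ) * N := by ring
  -- conclusion
  calc W.linkMass Sb ν' e ≤ _ := h0
    _ = _ := hswap
    _ ≤ _ := h1
    _ = _ := hsplit
    _ ≤ K.D * Γ * (1 / W.κ + 4 * σ / γ) * N + K.D * Γ * (4 * σ / γ) * N := add_le_add hPartA hPartB
    _ = K.D * Γ * (1 / W.κ + 8 * σ / γ) * N := by ring

/-- **GEOMETRIC ITERATION (ours, PROVED).** Along a sequence of transfer steps with the same constants,
`N_e(ν_k) ≤ θ₀^k · N₀`, `θ₀ = D · Γ · (1/κ + 8σ/γ)`: the volume enters only through `D`, so on the tori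
`(ℤ/L)^d` (`D = 2(d-1)` for all `L ≥ 3`) the rate is UNIFORM IN `L` — the mechanism of THEOREM A. -/
theorem linkMass_iterate_le {S : ℕ → Finset M} {μ : ℕ → M → ℝ} {Tk : ℕ → P → E → M → M → ℝ}
    (h : ∀ k, IsTransferStep K W σ γ Γ (S k) (S (k + 1)) (μ k) (μ (k + 1)) (Tk k)) {N₀ : ℝ}
    (h0 : ∀ e, W.linkMass (S 0) (μ 0) e ≤ N₀) (k : ℕ) (e : E) :
    W.linkMass (S k) (μ k) e ≤ (K.D * Γ * (1 / W.κ + 8 * σ / γ)) ^ k * N₀ := by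
  induction k generalizing e with
  | zero => simpa using h0 e
  | succ k ih =>
    calc W.linkMass (S (k + 1)) (μ (k + 1)) e
        ≤ K.D * Γ * (1 / W.κ + 8 * σ / γ) * ((K.D * Γ * (1 / W.κ + 8 * σ / γ)) ^ k * N₀) :=
          linkMass_le (h k) ih e
      _ = (K.D * Γ * (1 / W.κ + 8 * σ / γ)) ^ (k + 1) * N₀ := by ring

/-- The same with any `θ ≥ θ₀` and in the `C · ρ⁻¹ ^ k` format of `LuscherGeometricGradientBound`
(`ρ = θ⁻¹`; PROVED). -/
theorem linkMass_iterate_le_of_le {S : ℕ → Finset M} {μ : ℕ → M → ℝ} {Tk : ℕ → P → E → M → M → ℝ}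
    (h : ∀ k, IsTransferStep K W σ γ Γ (S k) (S (k + 1)) (μ k) (μ (k + 1)) (Tk k)) {N₀ θ : ℝ}
    (h0 : ∀ e, W.linkMass (S 0) (μ 0) e ≤ N₀) (hθ : K.D * Γ * (1 / W.κ + 8 * σ / γ) ≤ θ)
    (k : ℕ) (e : E) :
    W.linkMass (S k) (μ k) e ≤ N₀ * (θ⁻¹)⁻¹ ^ k := by
  have hN₀ : 0 ≤ N₀ := (W.linkMass_nonneg (h 0).ν_nonneg e).trans (h0 e)
  have hθ₀ : 0 ≤ K.D * Γ * (1 / W.κ + 8 * σ / γ) := by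
    have := (h 0).Γ_nonneg; have := (h 0).σ_nonneg; have := (h 0).γ_pos; have := W.κ_pos
    positivity
  rw [inv_inv, mul_comm]
  calc W.linkMass (S k) (μ k) e ≤ (K.D * Γ * (1 / W.κ + 8 * σ / γ)) ^ k * N₀ :=
        linkMass_iterate_le h h0 k e
    _ ≤ θ ^ k * N₀ := mul_le_mul_of_nonneg_right (pow_le_pow_left₀ hθ₀ hθ k) hN₀

end Step

end Summit.Ventures.LatticeQCDFlow.TrivializingMaps.MassTransfer
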